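import Literature.MathematicalPhysics.QuantumFieldTheory.Balaban1983to89.Beta.PolarizationSign
import Literature.MathematicalPhysics.QuantumFieldTheory.Balaban1983to89.Beta.DriftRemainder

/-!
# Score-projection floor — sketch for crux idea `score-projection-floor` on K2⁷
(`stmt-QuantumFields-20543`, `Summit.QuantumFields.YangMills.Theses.BalabanUVNodes.EndpointGivenBR13SepCoPH`)

HONEST FRAMING. Nothing in this file bears on the Yang–Mills mass gap (Clay). Route R4 `BalabanUVNodes` closes only
the CONDITIONAL finite-𝕋⁴ rung `BalabanLadder.UV`; [Balaban1987RG1] Thm 2 ∕ (0.31) p. 259 is unproved in print; the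
crux is OPEN. This file types the KERNEL half of the idea card and its END hook by name. The MEASURE half (Schur
complement of the joint covariance of the current with a score-generated trial family — Mathlib
`Matrix.PosSemidef.fromBlocks₁₁` — and integration by parts against the interacting score, which turns every entry of
the Cramér–Rao quotient into a FIRST moment of a local functional) is described in the card, not typed here.

* §1 `cos_le_taylor_four` (folklore; the tree has it only as a `private` lemma elsewhere).
* §2 EXACT PINCH (two lines over `Beta.PolarizationSign`): if the defect `Q = Π_νν − N` of a comparison kernel has zero
  sum and non-negative plane-wave sums along the transverse axis `μ`, then `β = secondMoment Π μ ν ≥ −½ Σ_z N(z) z_μ²`.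
* §3 APPROXIMATE PINCH (the new kernel fact): with defect sum `δ = Σ_z Q(z) ≥ 0` instead of `0`,
  `p²·(½ Σ_z Q z_μ²) ≤ δ + (p⁴/24)·Σ_z |Q| z_μ⁴` for EVERY real `p`; optimising, the curvature defect is `≤ √(δ·m₄/6)`.
  So a form inequality whose `p⁰` parts differ by `δ = O(g_k²)` still orders the `p²`-coefficients up to `O(g_k)` —
  the one-sided (AF-1)-type remainder currency END consumes.
* §4 END HOOK: a floor `β_{k+1} ≥ β⁰_{k+1} − C·g_k` on the boxes `]0,γ₀]^{k+1}` with `C γ₀ ≤ b` feeds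
  `Beta.DriftRemainder.endpointExistence_of_drift_oneSided` verbatim (drift (D1), (UP), (C), `ForwardGenerated` by name).
-/

namespace Summit.QuantumFields.YangMills.Cruxes.EndpointGivenBR13SepCoPH.ScoreProjectionFloor

open Literature.MathematicalPhysics.QuantumFieldTheory.Balaban1983to89
open Literature.MathematicalPhysics.QuantumFieldTheory.Balaban1983to89.Beta.PolarizationSign
open Filter Finset
open scoped Topology BigOperators

variable {d : ℕ}

/-! ## §1 The fourth-order cosine bound -/

/-- `cos x ≤ 1 − x²/2 + x⁴/24` for all real `x` (from Mathlib's `x − x³/6 ≤ sin x`, `x ≥ 0`, by one integration).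
[folklore] -/
theorem cos_le_taylor_four (x : ℝ) : Real.cos x ≤ 1 - x ^ 2 / 2 + x ^ 4 / 24 := by
  wlog hx : 0 ≤ x
  · have h := this (-x) (by linarith)
    rw [Real.cos_neg] at h
    have e2 : (-x) ^ 2 = x ^ 2 := by ring
    have e4 : (-x) ^ 4 = x ^ 4 := by ring
    rw [e2, e4] at h
    exact h
  let f (t : ℝ) : ℝ := 1 - t ^ 2 / 2 + t ^ 4 / 24 - Real.cos t
  have hderiv (t : ℝ) : deriv f t = -t + t ^ 3 / 6 + Real.sin t := by
    simp (disch := fun_prop) [f]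
    ring
  have hmono : MonotoneOn f (Set.Ici 0) := by
    apply monotoneOn_of_deriv_nonneg (convex_Ici 0) (by fun_prop) (by fun_prop)
    intro t ht
    rw [interior_Ici] at ht
    rw [hderiv]
    have := Real.sin_ge_sub_cube (le_of_lt ht)
    linarith
  have h0 : f 0 ≤ f x := hmono (by simp) (by simpa using hx) hx
  simp only [f, Real.cos_zero] at h0
  linarith

/-- The plane-wave weight squeezed between the second and fourth Taylor terms:
`0 ≤ p²x²/2 − (1 − cos(px)) ≤ p⁴x⁴/24`. [folklore] -/
theorem weight_bounds (p x : ℝ) :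
    0 ≤ p ^ 2 * x ^ 2 / 2 - (1 - Real.cos (p * x)) ∧
      p ^ 2 * x ^ 2 / 2 - (1 - Real.cos (p * x)) ≤ p ^ 4 * x ^ 4 / 24 := by
  have h1 : 1 - (p * x) ^ 2 / 2 ≤ Real.cos (p * x) := Real.one_sub_sq_div_two_le_cos
  have h2 := cos_le_taylor_four (p * x)
  have e2 : (p * x) ^ 2 = p ^ 2 * x ^ 2 := by ring
  have e4 : (p * x) ^ 4 = p ^ 4 * x ^ 4 := by ring
  rw [e2] at h1
  rw [e2, e4] at h2
  constructor <;> linarith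

/-! ## §2 Exact pinch: a Ward-tight non-negative defect gives a β-comparison -/

/-- **β-COMPARISON UNDER AN EXACTLY PINCHED DEFECT.** `P` a kernel with the printed structure (5.7)–(5.9) and summable
third moments (so `β = secondMoment P μ ν = −½ Σ_z P_νν(z) z_μ²`, `Beta.PolarizationSign.secondMoment_eq_neg_half`),
`N` the `νν`-entry of a comparison kernel (in the card: projected paramagnetic kernel minus diamagnetic kernel) whose
DEFECT `Q = P_νν − N` has zero sum, non-negative plane-wave sums along `μ` and summable second moment: then
`β ≥ −½ Σ_z N(z) z_μ²`.  Two lines over `weighted_second_moment_nonpos`. [folklore] -/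
theorem secondMoment_ge_of_pinchedDefect {P : B12Beta.Kernel d} (hP : MomentSummable P 3)
    (hT : WardTransversal P) (hR : AxisReflectionCovariant P) {μ ν : Fin d} (hμν : μ ≠ ν)
    (N : (Fin d → ℤ) → ℝ) (hN2 : Summable fun z => N z * (z μ : ℝ) ^ 2)
    (hQ : Summable fun z => |P ν ν z - N z|)
    (hQ2 : Summable fun z => |P ν ν z - N z| * (z μ : ℝ) ^ 2)
    (h0 : ∑' z, (P ν ν z - N z) = 0)
    (hB : ∀ p : ℝ, 0 ≤ ∑' z, (P ν ν z - N z) * Real.cos (p * z μ)) :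
    -(1 / 2) * ∑' z, N z * (z μ : ℝ) ^ 2 ≤ B12Beta.secondMoment P μ ν := by
  have e := secondMoment_eq_neg_half hP hT hμν (first_moment_eq_zero hR hμν)
  have w := weighted_second_moment_nonpos (fun z => P ν ν z - N z) μ hQ hQ2 h0 hB
  have hPs : Summable fun z => P ν ν z * (z μ : ℝ) ^ 2 :=
    Summable.of_norm_bounded (hP.summable_abs_mul_sq ν ν μ) fun z => by
      rw [Real.norm_eq_abs, abs_mul, abs_pow, sq_abs]
  have hsplit : ∑' z, (P ν ν z - N z) * (z μ : ℝ) ^ 2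
      = ∑' z, P ν ν z * (z μ : ℝ) ^ 2 - ∑' z, N z * (z μ : ℝ) ^ 2 := by
    rw [← Summable.tsum_sub hPs hN2]
    exact tsum_congr fun z => by ring
  rw [hsplit] at w
  rw [e]
  linarith

/-! ## §3 Approximate pinch: a small defect sum costs only a small curvature defect -/

/-- **CURVATURE DEFECT UNDER AN APPROXIMATELY PINCHED NON-NEGATIVE SYMBOL.** For an absolutely summable `Q` with
summable second and fourth moments along the axis `α` and ALL plane-wave sums `Σ_z Q(z) cos(p z_α) ≥ 0`:
`p² · (½ Σ_z Q(z) z_α²) ≤ Σ_z Q(z) + (p⁴/24) · Σ_z |Q(z)| z_α⁴` for every real `p`.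
(With `δ := Σ_z Q`, `m₄ := Σ|Q| z⁴`: `½ Σ Q z² ≤ δ/p² + p² m₄/24`, optimum `√(δ m₄ / 6)` at `p⁴ = 24δ/m₄`; `δ = 0`
recovers `weighted_second_moment_nonpos`.)  Proof: `p²x²/2 = (1 − cos px) + w(p,x)`, `0 ≤ w ≤ p⁴x⁴/24`. [folklore] -/
theorem sq_mul_half_weighted_second_moment_le (Q : (Fin d → ℤ) → ℝ) (α : Fin d)
    (hQ : Summable fun z => |Q z|) (h2 : Summable fun z => |Q z| * (z α : ℝ) ^ 2)
    (h4 : Summable fun z => |Q z| * (z α : ℝ) ^ 4)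
    (hB : ∀ p : ℝ, 0 ≤ ∑' z, Q z * Real.cos (p * z α)) (p : ℝ) :
    p ^ 2 * ((1 / 2) * ∑' z, Q z * (z α : ℝ) ^ 2)
      ≤ (∑' z, Q z) + p ^ 4 / 24 * ∑' z, |Q z| * (z α : ℝ) ^ 4 := by
  set w : (Fin d → ℤ) → ℝ := fun z => p ^ 2 * (z α : ℝ) ^ 2 / 2 - (1 - Real.cos (p * z α)) with hw
  have hw0 : ∀ z, 0 ≤ w z := fun z => (weight_bounds p (z α)).1
  have hw4 : ∀ z, w z ≤ p ^ 4 * (z α : ℝ) ^ 4 / 24 := fun z => (weight_bounds p (z α)).2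
  have hQ' : Summable Q := Summable.of_norm_bounded hQ (fun z => le_rfl)
  have hcos : Summable fun z => Q z * Real.cos (p * z α) :=
    Summable.of_norm_bounded hQ fun z => by
      rw [Real.norm_eq_abs, abs_mul]
      exact mul_le_of_le_one_right (abs_nonneg _) (Real.abs_cos_le_one _)
  have hs1 : Summable fun z => Q z * (1 - Real.cos (p * z α)) := by
    have : (fun z => Q z * (1 - Real.cos (p * z α))) = fun z => Q z - Q z * Real.cos (p * z α) := by
      funext z; ring
    rw [this]
    exact hQ'.sub hcos
  have hs4 : Summable fun z => p ^ 4 / 24 * (|Q z| * (z α : ℝ) ^ 4) := h4.mul_left _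
  have hs2 : Summable fun z => Q z * w z :=
    Summable.of_norm_bounded hs4 fun z => by
      rw [Real.norm_eq_abs, abs_mul, abs_of_nonneg (hw0 z)]
      have := hw4 z
      have hq := abs_nonneg (Q z)
      nlinarith
  have hsS : Summable fun z => Q z * (z α : ℝ) ^ 2 :=
    Summable.of_norm_bounded h2 fun z => by
      rw [Real.norm_eq_abs, abs_mul, abs_pow, sq_abs]
  -- rewrite the left side as a sum of the two pieces
  have eL : p ^ 2 * ((1 / 2) * ∑' z, Q z * (z α : ℝ) ^ 2) = ∑' z, Q z * (p ^ 2 * (z α : ℝ) ^ 2 / 2) := by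
    rw [← mul_assoc, ← tsum_mul_left]
    exact tsum_congr fun z => by ring
  have eS : ∑' z, Q z * (p ^ 2 * (z α : ℝ) ^ 2 / 2)
      = ∑' z, Q z * (1 - Real.cos (p * z α)) + ∑' z, Q z * w z := by
    rw [← Summable.tsum_add hs1 hs2]
    exact tsum_congr fun z => by simp only [hw]; ring
  have A : ∑' z, Q z * (1 - Real.cos (p * z α)) ≤ ∑' z, Q z := by
    have e1 : ∑' z, Q z * (1 - Real.cos (p * z α)) = ∑' z, Q z - ∑' z, Q z * Real.cos (p * z α) := by
      rw [← Summable.tsum_sub hQ' hcos]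
      exact tsum_congr fun z => by ring
    rw [e1]
    linarith [hB p]
  have B : ∑' z, Q z * w z ≤ p ^ 4 / 24 * ∑' z, |Q z| * (z α : ℝ) ^ 4 := by
    rw [← tsum_mul_left]
    refine Summable.tsum_le_tsum (fun z => ?_) hs2 hs4
    have hq := le_abs_self (Q z)
    have := hw4 z
    have := hw0 z
    have hqa := abs_nonneg (Q z)
    nlinarith
  rw [eL, eS]
  linarith

/-- The β-form of §3: for `P` with (5.7)–(5.9) and a comparison entry `N` whose defect `Q = P_νν − N` has
non-negative plane-wave sums along `μ` and summable moments, for every real `p`: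
`p²·β ≥ p²·(−½ Σ N z_μ²) − Σ_z Q − (p⁴/24) Σ|Q| z_μ⁴`.  In the card `Σ_z Q = O(g_k²)` (variance of an `O(g_k)`
observable), the moments are `O(1)`, and `p² ≍ g_k` gives the floor `β ≥ β_N − O(g_k)`. [folklore] -/
theorem sq_mul_secondMoment_ge_of_defect {P : B12Beta.Kernel d} (hP : MomentSummable P 3)
    (hT : WardTransversal P) (hR : AxisReflectionCovariant P) {μ ν : Fin d} (hμν : μ ≠ ν)
    (N : (Fin d → ℤ) → ℝ) (hN2 : Summable fun z => N z * (z μ : ℝ) ^ 2)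
    (hQ : Summable fun z => |P ν ν z - N z|)
    (hQ2 : Summable fun z => |P ν ν z - N z| * (z μ : ℝ) ^ 2)
    (hQ4 : Summable fun z => |P ν ν z - N z| * (z μ : ℝ) ^ 4)
    (hB : ∀ p : ℝ, 0 ≤ ∑' z, (P ν ν z - N z) * Real.cos (p * z μ)) (p : ℝ) :
    p ^ 2 * (-(1 / 2) * ∑' z, N z * (z μ : ℝ) ^ 2) - (∑' z, (P ν ν z - N z))
        - p ^ 4 / 24 * ∑' z, |P ν ν z - N z| * (z μ : ℝ) ^ 4
      ≤ p ^ 2 * B12Beta.secondMoment P μ ν := by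
  have e := secondMoment_eq_neg_half hP hT hμν (first_moment_eq_zero hR hμν)
  have m := sq_mul_half_weighted_second_moment_le (fun z => P ν ν z - N z) μ hQ hQ2 hQ4 hB p
  have hPs : Summable fun z => P ν ν z * (z μ : ℝ) ^ 2 :=
    Summable.of_norm_bounded (hP.summable_abs_mul_sq ν ν μ) fun z => by
      rw [Real.norm_eq_abs, abs_mul, abs_pow, sq_abs]
  have hsplit : ∑' z, (P ν ν z - N z) * (z μ : ℝ) ^ 2
      = ∑' z, P ν ν z * (z μ : ℝ) ^ 2 - ∑' z, N z * (z μ : ℝ) ^ 2 := by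
    rw [← Summable.tsum_sub hPs hN2]
    exact tsum_congr fun z => by ring
  rw [hsplit] at m
  rw [e]
  have hp2 : 0 ≤ p ^ 2 := by positivity
  nlinarith [m, hp2]

/-! ## §4 The END hook by name -/

open FlowStep FlowStepRuns DagBinding
open Literature.MathematicalPhysics.QuantumFieldTheory.Balaban1983to89.Beta.Drift (OneLoopDrift)
open Literature.MathematicalPhysics.QuantumFieldTheory.Balaban1983to89.Beta.DriftRemainder
  (endpointExistence_of_drift_oneSided)

/-- **ENDPOINT EXISTENCE FROM A ONE-SIDED (AF-1)-TYPE FLOOR.** If on the boxes `]0,γ₀]^{k+1}` the step β-functions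
satisfy the floor `β⁰_{k+1} − C·g_k ≤ β_{k+1}(g_0,…,g_k)` (k-uniform `C ≥ 0`) — the output of the score-projection road —
then with the one-loop drift (D1), `C·γ₀ ≤ b`, the printed-type upper bound (UP) and joint continuity (C), a
forward-generated construction has the endpoint property.  Pure plumbing into
`Beta.DriftRemainder.endpointExistence_of_drift_oneSided` (`r := C γ₀`).  States NOTHING about Bałaban's β.
[cite: Balaban1987RG1, Thm 2 p.259 (first sentence)] -/
theorem endpointExistence_of_floor {C : B12.Construction} {β : HBeta} (hgen : ForwardGenerated C β)
    (S : B12Beta.OneLoopSplit β) {γ₀ b A Cf β' : ℝ} (hγ₀ : 0 < γ₀) (hdrift : OneLoopDrift b A S.β0)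
    (hCf : 0 ≤ Cf)
    (hfloor : ∀ k (p : Fin (k + 1) → ℝ), p ∈ B12Beta.HistBox γ₀ k → S.β0 k - Cf * p (Fin.last k) ≤ β k p)
    (hr : Cf * γ₀ ≤ b) (hβ' : 0 ≤ β') (hcont : BetaContH γ₀ β) (hup : BetaUpperH β' γ₀ β) :
    EndpointExistence C :=
  endpointExistence_of_drift_oneSided hgen S hγ₀ hdrift (r := Cf * γ₀)
    (fun k p hp => by
      have h1 := hfloor k p hp
      have h2 : S.β1 k p = β k p - S.β0 k := by
        have := S.split k p
        linarith
      have h3 : p (Fin.last k) ≤ γ₀ := (hp (Fin.last k)).2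
      rw [h2]
      nlinarith [mul_le_mul_of_nonneg_left h3 hCf])
    hr hβ' hcont hup

end Summit.QuantumFields.YangMills.Cruxes.EndpointGivenBR13SepCoPH.ScoreProjectionFloor
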